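import Literature.NumberTheory.Automorphic.HermitianLatticesAdaptedPlane
import Literature.NumberTheory.Automorphic.UnitaryGroupAutomorphicRep
import HarnessLib

/-!
# The split Hermitian space `(K^N, J₀ = antidiag(1,…,1))`: the form `B₀`, the standard lattice `𝒪^N` and
# its coordinate sub-lattices (Tits 1979 §3.3; O'Meara §82F; Mok 2015 §1)

Topic `NumberTheory/Automorphic`; namespace `Literature.NumberTheory.Automorphic.HermitianLattice`.
Plumbing definitions (`B₀`, `stdLattice`, `frame`, `frameLattice`) and fully proved lemmas; no named fact,
no `sorry`. Setting of `HermitianLatticesLocal` (`Valued K ℤᵐ⁰`, a ring endomorphism `σ` of `K`).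

* `B₀ σ N` — the `σ`-sesquilinear form `B₀ x y = ∑ i, σ (x i) * y (rev i)` of Mok's antidiagonal matrix
  `J₀ = (StdForm.antidiagonal N).over K`, Hermitian when `σ² = 1`; `mem_unitaryGroupOfForm_antidiagonal_iff` —
  `g ∈ U(σ, J₀)` (the tree's `unitaryGroupOfForm`) iff `g` preserves `B₀` (the matrix identity `(σg)ᵀ J₀ g = J₀`
  read column by column, `B₀_mulVec_mulVec`).
* `stdLattice K N = 𝒪^N`, `frame K N S = K^S ⊆ K^N` and `frameLattice K N S = 𝒪^S` for `S ⊆ Fin N`;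
  `isUnimodularLattice_frameLattice` — `𝒪^S` is a unimodular lattice in `K^S` for `B₀` when `S` is stable
  under `rev` (in particular `𝒪^N` in `K^N`: the hyperspecial vertex); `frame_inf_orth_single` — the orthogonal
  of the standard hyperbolic pair `(e i, e (rev i))` in `K^S` is `K^{S ∖ {i, rev i}}`.

These are the coordinate frames of the lattice proof of the Cartan decomposition `U(J₀)(K) = K₀ T K₀` of the
quasi-split unitary group relative to its hyperspecial subgroup `K₀ = U(J₀) ∩ GL_N(𝒪)` (cell hodgecm-mathlib,
row IV-9, line `b4-hyperspecial-gelfand-pair`, sub-stub (2b) `CartanAntidiag`).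

References: J. Tits, *Reductive groups over local fields*, PSPUM 33.1 (1979), §3.3.3 [Tits1979];
O. T. O'Meara, *Introduction to Quadratic Forms* (1963), §42D, §81A, §82F [Omeara1963];
C. P. Mok, Mem. AMS 235 (2015), §1 Notation (the form `J_N`) [Mok2014].
-/

noncomputable section

open scoped Valued WithZero Matrix

namespace Literature.NumberTheory.Automorphic.HermitianLattice

variable {K : Type*} [Field K] (σ : K →+* K) (N : ℕ)

/-! ## §1 The form `B₀` of the antidiagonal matrix -/

/-- The `σ`-sesquilinear form of `J₀ = antidiag(1,…,1)`: `B₀ x y = ∑ i, σ (x i) * y (rev i)` (`= (σ x)ᵀ J₀ y`).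
[cite: Mok2014, §1 Notation p. 5] -/
def B₀ : (Fin N → K) →ₛₗ[σ] (Fin N → K) →ₗ[K] K :=
  LinearMap.mk₂'ₛₗ σ (RingHom.id K) (fun x y => ∑ i, σ (x i) * y (Fin.rev i))
    (fun x x' y => by simp only [Pi.add_apply, map_add, add_mul, Finset.sum_add_distrib])
    (fun a x y => by simp only [Pi.smul_apply, smul_eq_mul, map_mul, mul_assoc, Finset.mul_sum])
    (fun x y y' => by simp only [Pi.add_apply, mul_add, Finset.sum_add_distrib])
    (fun a x y => by
      simp only [Pi.smul_apply, smul_eq_mul, RingHom.id_apply, Finset.mul_sum]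
      exact Finset.sum_congr rfl fun i _ => by ring)

variable {σ N}

/-- `B₀ x y = ∑ i, σ (x i) * y (rev i)`. [cite: Mok2014, §1 Notation p. 5] -/
@[simp] theorem B₀_apply (x y : Fin N → K) : B₀ σ N x y = ∑ i, σ (x i) * y (Fin.rev i) := rfl

/-- `B₀ (e a) z = z (rev a)`. [cite: Mok2014, §1 Notation p. 5] -/
@[simp] theorem B₀_single_left (a : Fin N) (z : Fin N → K) : B₀ σ N (Pi.single a 1) z = z (Fin.rev a) := by
  rw [B₀_apply, Finset.sum_eq_single a]
  · rw [Pi.single_eq_same, map_one, one_mul]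
  · intro b _ hb; rw [Pi.single_eq_of_ne hb, map_zero, zero_mul]
  · intro h; exact absurd (Finset.mem_univ a) h

/-- `B₀ z (e a) = σ (z (rev a))`. [cite: Mok2014, §1 Notation p. 5] -/
@[simp] theorem B₀_single_right (z : Fin N → K) (a : Fin N) :
    B₀ σ N z (Pi.single a 1) = σ (z (Fin.rev a)) := by
  rw [B₀_apply, Finset.sum_eq_single (Fin.rev a)]
  · rw [Fin.rev_rev, Pi.single_eq_same, mul_one]
  · intro b _ hb
    rw [Pi.single_eq_of_ne (fun h => hb (by rw [← h, Fin.rev_rev])), mul_zero]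
  · intro h; exact absurd (Finset.mem_univ _) h

/-- `B₀ (e a) (e b) = [b = rev a]`. [cite: Mok2014, §1 Notation p. 5] -/
theorem B₀_single_single (a b : Fin N) :
    B₀ σ N (Pi.single a 1) (Pi.single b 1) = if b = Fin.rev a then 1 else 0 := by
  rw [B₀_single_left, Pi.single_apply]
  by_cases h : b = Fin.rev a
  · rw [if_pos h, if_pos h.symm]
  · rw [if_neg h, if_neg (fun h' => h h'.symm)]

/-- Splitting a sum over `Fin N` at a pair `{i, rev i}` of distinct indices. [cite: Tits1979, §3.3.3] -/
theorem sum_eq_add_add_sum_erase {M : Type*} [AddCommMonoid M] {i : Fin N} (hi : Fin.rev i ≠ i)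
    (f : Fin N → M) : ∑ k, f k = f i + f (Fin.rev i) + ∑ k ∈ (Finset.univ.erase i).erase (Fin.rev i), f k := by
  rw [← Finset.add_sum_erase _ _ (Finset.mem_univ i),
    ← Finset.add_sum_erase _ _ (Finset.mem_erase.2 ⟨hi, Finset.mem_univ _⟩), add_assoc]

/-- Membership in the doubly erased index set. [cite: Tits1979, §3.3.3] -/
theorem mem_erase_erase {i k : Fin N} :
    k ∈ (Finset.univ.erase i).erase (Fin.rev i) ↔ k ≠ i ∧ k ≠ Fin.rev i := by
  simp only [Finset.mem_erase, Finset.mem_univ, and_true]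
  tauto

/-- `B₀ z w` split at `{i, rev i}`. [cite: Mok2014, §1 Notation p. 5] -/
theorem B₀_eq_add_add_sum {i : Fin N} (hi : Fin.rev i ≠ i) (z w : Fin N → K) :
    B₀ σ N z w = σ (z i) * w (Fin.rev i) + σ (z (Fin.rev i)) * w i +
      ∑ k ∈ (Finset.univ.erase i).erase (Fin.rev i), σ (z k) * w (Fin.rev k) := by
  rw [B₀_apply, sum_eq_add_add_sum_erase hi, Fin.rev_rev]

/-- `B₀` is Hermitian when `σ` is an involution. [cite: Mok2014, §1 Notation p. 5] -/
theorem isHermitianForm_B₀ (hσ : ∀ a, σ (σ a) = a) : IsHermitianForm (B₀ σ N) := by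
  intro x y
  rw [B₀_apply, B₀_apply, map_sum]
  exact Fintype.sum_equiv Fin.revPerm _ _ fun i => by
    rw [Fin.revPerm_apply, Fin.rev_rev, map_mul, hσ, mul_comm]

/-- Column expansion: `B₀ (A u) (A v) = ∑_{a,b} σ (u a) v b ((σ A)ᵀ J₀ A) a b`. [cite: Mok2014, §1 Notation p. 5] -/
theorem B₀_mulVec_mulVec (A : Matrix (Fin N) (Fin N) K) (u v : Fin N → K) :
    B₀ σ N (A.mulVec u) (A.mulVec v) =
      ∑ a, ∑ b, σ (u a) * v b * ((A.map σ)ᵀ * (StdForm.antidiagonal N).over K * A) a b := by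
  have hJ : ∀ i j : Fin N, (StdForm.antidiagonal N).over K i j = if j = Fin.rev i then 1 else 0 := by
    intro i j
    simp only [StdForm.over, Matrix.map_apply, StdForm.antidiagonal_J_apply]
    split_ifs <;> simp
  have hJA : ∀ i b, ((StdForm.antidiagonal N).over K * A) i b = A (Fin.rev i) b := by
    intro i b
    rw [Matrix.mul_apply, Finset.sum_eq_single (Fin.rev i)]
    · rw [hJ, if_pos rfl, one_mul]
    · intro j _ hj; rw [hJ, if_neg hj, zero_mul]
    · intro h; exact absurd (Finset.mem_univ _) h
  have hexp : ∀ a b, ((A.map σ)ᵀ * (StdForm.antidiagonal N).over K * A) a b = ∑ i, σ (A i a) * A (Fin.rev i) b := by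
    intro a b
    rw [Matrix.mul_assoc, Matrix.mul_apply]
    refine Finset.sum_congr rfl fun i _ => ?_
    rw [Matrix.transpose_apply, Matrix.map_apply, hJA]
  simp only [hexp, B₀_apply, Matrix.mulVec, dotProduct, map_sum, map_mul, Finset.sum_mul, Finset.mul_sum]
  -- LHS: `∑ i, ∑ a(v), ∑ b(u)`, RHS: `∑ a(u), ∑ b(v), ∑ i`
  conv_rhs => rw [Finset.sum_comm]
  rw [Finset.sum_comm]
  refine Finset.sum_congr rfl fun a _ => ?_
  rw [Finset.sum_comm]
  refine Finset.sum_congr rfl fun b _ => Finset.sum_congr rfl fun i _ => ?_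
  ring

/-- **`g ∈ U(σ, J₀)` iff `B₀ (g u) (g v) = B₀ u v` for all `u, v`.** [cite: Mok2014, §1 Notation p. 5] -/
theorem mem_unitaryGroupOfForm_antidiagonal_iff (g : GL (Fin N) K) :
    g ∈ unitaryGroupOfForm σ ((StdForm.antidiagonal N).over K) ↔
      ∀ u v, B₀ σ N ((g : Matrix (Fin N) (Fin N) K).mulVec u) ((g : Matrix (Fin N) (Fin N) K).mulVec v) =
        B₀ σ N u v := by
  have hJ : ∀ i j : Fin N, (StdForm.antidiagonal N).over K i j = if j = Fin.rev i then (1 : K) else 0 := by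
    intro i j
    simp only [StdForm.over, Matrix.map_apply, StdForm.antidiagonal_J_apply]
    split_ifs <;> simp
  rw [mem_unitaryGroupOfForm_iff]
  constructor
  · intro h u v
    rw [B₀_mulVec_mulVec, h, B₀_apply]
    refine Finset.sum_congr rfl fun a _ => ?_
    rw [Finset.sum_eq_single (Fin.rev a)]
    · rw [hJ, if_pos rfl, mul_one]
    · intro b _ hb; rw [hJ, if_neg hb, mul_zero]
    · intro h'; exact absurd (Finset.mem_univ _) h'
  · intro h
    ext a b
    have hab := h (Pi.single a 1) (Pi.single b 1)
    rw [B₀_mulVec_mulVec, B₀_single_single] at hab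
    simp only [Pi.single_apply, apply_ite σ, map_one, map_zero, ite_mul, one_mul, zero_mul, mul_ite, mul_one,
      mul_zero, Finset.sum_ite_eq', Finset.mem_univ, if_true] at hab
    rw [hab, hJ]

/-! ## §2 The standard lattice and coordinate frames -/

section Lattices

variable (K N) [Valued K ℤᵐ⁰]

/-- The standard lattice `𝒪^N ⊆ K^N`. [cite: Omeara1963, §81A] -/
def stdLattice : Submodule 𝒪[K] (Fin N → K) where
  carrier := {v | ∀ i, Valued.v (v i) ≤ 1}
  add_mem' {a b} ha hb i := by
    rw [Pi.add_apply]; exact (Valuation.map_add _ _ _).trans (max_le (ha i) (hb i))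
  zero_mem' i := by simp
  smul_mem' c {x} hx i := by
    change Valued.v ((c : K) * x i) ≤ 1
    rw [map_mul]
    exact mul_le_one' ((mem_integer_iff' _).1 c.2) (hx i)

/-- The coordinate subspace `K^S = {v | v i = 0 for i ∉ S}`. [cite: Tits1979, §3.3.3] -/
def frame (S : Finset (Fin N)) : Submodule K (Fin N → K) where
  carrier := {v | ∀ i, i ∉ S → v i = 0}
  add_mem' {a b} ha hb i hi := by rw [Pi.add_apply, ha i hi, hb i hi, add_zero]
  zero_mem' _ _ := rfl
  smul_mem' c {x} hx i hi := by rw [Pi.smul_apply, hx i hi, smul_zero]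

/-- The coordinate lattice `𝒪^S = 𝒪^N ∩ K^S`. [cite: Tits1979, §3.3.3] -/
def frameLattice (S : Finset (Fin N)) : Submodule 𝒪[K] (Fin N → K) :=
  stdLattice K N ⊓ (frame K N S).restrictScalars 𝒪[K]

variable {K N}

/-- Membership in `stdLattice`. [cite: Omeara1963, §81A] -/
theorem mem_stdLattice {v : Fin N → K} : v ∈ stdLattice K N ↔ ∀ i, Valued.v (v i) ≤ 1 := Iff.rfl

/-- `e i ∈ 𝒪^N`. [cite: Omeara1963, §81A] -/
theorem single_mem_stdLattice (i : Fin N) : (Pi.single i 1 : Fin N → K) ∈ stdLattice K N := by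
  intro j
  rw [Pi.single_apply]
  split_ifs <;> simp

omit [Valued K ℤᵐ⁰] in
/-- Membership in `frame S`. [cite: Tits1979, §3.3.3] -/
theorem mem_frame {S : Finset (Fin N)} {v : Fin N → K} : v ∈ frame K N S ↔ ∀ i, i ∉ S → v i = 0 :=
  Iff.rfl

omit [Valued K ℤᵐ⁰] in
/-- `frame univ = ⊤`. [cite: Tits1979, §3.3.3] -/
theorem frame_univ : frame K N (Finset.univ : Finset (Fin N)) = ⊤ :=
  eq_top_iff.2 fun _ _ i hi => absurd (Finset.mem_univ i) hi

omit [Valued K ℤᵐ⁰] in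
/-- `e i ∈ frame S` for `i ∈ S`. [cite: Tits1979, §3.3.3] -/
theorem single_mem_frame {S : Finset (Fin N)} {i : Fin N} (hi : i ∈ S) :
    (Pi.single i 1 : Fin N → K) ∈ frame K N S := by
  intro j hj
  rw [Pi.single_apply, if_neg]
  rintro rfl; exact hj hi

omit [Valued K ℤᵐ⁰] in
/-- A vector supported on `S` is the sum of its coordinates times the `e i`, `i ∈ S`. [cite: Tits1979, §3.3.3] -/
theorem eq_sum_single_of_mem_frame {S : Finset (Fin N)} {v : Fin N → K} (hv : v ∈ frame K N S) :
    v = ∑ i ∈ S, v i • (Pi.single i 1 : Fin N → K) := by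
  ext j
  simp only [Finset.sum_apply, Pi.smul_apply, Pi.single_apply, smul_eq_mul, mul_ite, mul_one, mul_zero,
    Finset.sum_ite_eq]
  by_cases hj : j ∈ S
  · rw [if_pos hj]
  · rw [if_neg hj, hv j hj]

/-- Membership in `frameLattice S`. [cite: Tits1979, §3.3.3] -/
theorem mem_frameLattice {S : Finset (Fin N)} {v : Fin N → K} :
    v ∈ frameLattice K N S ↔ (∀ i, Valued.v (v i) ≤ 1) ∧ ∀ i, i ∉ S → v i = 0 := by
  rw [frameLattice, Submodule.mem_inf, mem_stdLattice, Submodule.restrictScalars_mem, mem_frame]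

/-- `frameLattice univ = stdLattice`. [cite: Tits1979, §3.3.3] -/
theorem frameLattice_univ : frameLattice K N (Finset.univ : Finset (Fin N)) = stdLattice K N := by
  rw [frameLattice, frame_univ, Submodule.restrictScalars_top, inf_top_eq]

/-- `B₀` is integral on `𝒪^N` (`σ` preserving the valuation). [cite: Omeara1963, §82F] -/
theorem v_B₀_le_one (hvσ : ∀ a, Valued.v (σ a) = Valued.v a) {x y : Fin N → K}
    (hx : x ∈ stdLattice K N) (hy : y ∈ stdLattice K N) : Valued.v (B₀ σ N x y) ≤ 1 := by
  rw [B₀_apply]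
  refine Valuation.map_sum_le _ fun i _ => ?_
  rw [map_mul, hvσ]
  exact mul_le_one' (hx i) (hy _)

/-- **`𝒪^S` is a unimodular lattice in `K^S`** for `B₀`, when `S` is stable under `rev`. [cite: Omeara1963, §82F] -/
theorem isUnimodularLattice_frameLattice (hvσ : ∀ a, Valued.v (σ a) = Valued.v a) {S : Finset (Fin N)}
    (hS : ∀ i ∈ S, Fin.rev i ∈ S) : IsUnimodularLattice (B₀ σ N) (frame K N S) (frameLattice K N S) := by
  have hgen : ∀ i ∈ S, (Pi.single i 1 : Fin N → K) ∈ frameLattice K N S := fun i hi =>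
    mem_frameLattice.2 ⟨single_mem_stdLattice i, single_mem_frame hi⟩
  refine ⟨?_, ?_, ?_, ?_⟩
  · suffices h : frameLattice K N S = Submodule.span 𝒪[K] ((fun i => (Pi.single i 1 : Fin N → K)) '' S) by
      rw [h]; exact Submodule.fg_span ((S.finite_toSet).image _)
    apply le_antisymm
    · intro v hv
      obtain ⟨hv1, hv2⟩ := mem_frameLattice.1 hv
      rw [eq_sum_single_of_mem_frame hv2]
      exact Submodule.sum_mem _ fun i hi => smul_mem_of_v_le _ (hv1 i) (Submodule.subset_span ⟨i, hi, rfl⟩)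
    · rw [Submodule.span_le]
      rintro _ ⟨i, hi, rfl⟩
      exact hgen i hi
  · apply le_antisymm
    · rw [Submodule.span_le]
      intro v hv
      exact (mem_frameLattice.1 hv).2
    · intro v hv
      rw [eq_sum_single_of_mem_frame hv]
      exact Submodule.sum_mem _ fun i hi => Submodule.smul_mem _ _ (Submodule.subset_span (hgen i hi))
  · intro x hx y hy
    exact v_B₀_le_one hvσ (mem_frameLattice.1 hx).1 (mem_frameLattice.1 hy).1
  · intro z hz h
    refine mem_frameLattice.2 ⟨fun i => ?_, hz⟩
    by_cases hi : i ∈ S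
    · have := h (Pi.single (Fin.rev i) 1) (hgen _ (hS i hi))
      rwa [B₀_single_left, Fin.rev_rev] at this
    · rw [hz i hi, map_zero]; exact zero_le

omit [Valued K ℤᵐ⁰] in
/-- The orthogonal of the standard hyperbolic pair `(e i, e (rev i))` inside `K^S` is `K^{S ∖ {i, rev i}}`.
[cite: Omeara1963, §42D] -/
theorem frame_inf_orth_single (S : Finset (Fin N)) (i : Fin N) :
    frame K N S ⊓ orth (B₀ σ N) (Pi.single i 1) (Pi.single (Fin.rev i) 1) =
      frame K N ((S.erase i).erase (Fin.rev i)) := by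
  ext v
  simp only [Submodule.mem_inf, mem_frame, mem_orth, B₀_single_left, Fin.rev_rev, Finset.mem_erase, ne_eq,
    not_and]
  constructor
  · rintro ⟨h1, h2, h3⟩ j hj
    by_cases hji : j = Fin.rev i
    · rw [hji]; exact h2
    by_cases hji' : j = i
    · rw [hji']; exact h3
    · exact h1 j (fun hjS => hj hji hji' hjS)
  · intro h
    exact ⟨fun j hj => h j (fun _ _ hjS => hj hjS), h _ (fun h' _ _ => h' rfl), h i (fun _ h' _ => h' rfl)⟩

/-- … and the same for the lattices. [cite: Omeara1963, §82F] -/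
theorem frameLattice_inf_orthInt_single (S : Finset (Fin N)) (i : Fin N) :
    frameLattice K N S ⊓ orthInt (B₀ σ N) (Pi.single i 1) (Pi.single (Fin.rev i) 1) =
      frameLattice K N ((S.erase i).erase (Fin.rev i)) := by
  rw [frameLattice, frameLattice, orthInt, inf_assoc, ← Submodule.restrictScalars_inf]
  congr 2
  exact frame_inf_orth_single S i

omit [Valued K ℤᵐ⁰] in
/-- The standard pair `(e i, e (rev i))` is hyperbolic when `i ≠ rev i`. [cite: Omeara1963, §42D] -/
theorem isHyperbolicPair_single {i : Fin N} (hi : Fin.rev i ≠ i) :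
    IsHyperbolicPair (B₀ σ N) (Pi.single i 1) (Pi.single (Fin.rev i) 1) := by
  refine ⟨?_, ?_, ?_⟩
  · rw [B₀_single_single, if_neg hi.symm]
  · rw [B₀_single_single, Fin.rev_rev, if_neg hi]
  · rw [B₀_single_single, if_pos rfl]

end Lattices

end Literature.NumberTheory.Automorphic.HermitianLattice

end
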